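import Literature.Barriers.CriticalPhenomena.SupercriticalSAWSpaceFillingTilesDichotomy
import Literature.Barriers.CriticalPhenomena.SupercriticalSAWSpaceFillingTilesMeasure
import Literature.Probability.RandomPlanarGeometry.SAWSpliceBound
import Literature.Probability.RandomPlanarGeometry.SAWSpliceGeometry
import Literature.Probability.RandomPlanarGeometry.SAWTileFamilies
import HarnessLib

/-!
# Supercritical SAW (Duminil-Copin–Kozma–Yadin 2014), Theorem 6 for the disk via odd tiles:
# the energy–entropy bound of the main case (Proposition 7 in list form, proved)

Tile form of Proposition 7 of H. Duminil-Copin, G. Kozma, A. Yadin, *Supercritical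
self-avoiding walks are space-filling*, Ann. IHP Probab. Stat. 50 (2014), §3, for `Ω = 𝔻`:
for a connected family `𝒞` of deep tiles, a deep tile `t' ∉ 𝒞` adjacent to `t = t' + dp ∈ 𝒞`,
and a sphere radius `d₀` with `2A + 12 ≤ d₀`, `2L ≤ d₀ ≤ ρ ≤ Rd`, the walks (as vertex lists in
`𝔻_δ` from `u` to `v`) for which every tile of `𝒞` is clear with radius `ρ` and whose
`ℓ¹`-distance from the centre of `t'` is exactly `d₀` satisfy
`G(E) · x^{(4r+2)(|𝒞|-1)} Z_m(x)^{|𝒞|} ≤ 80 (d₀+1) max(1,x⁻¹)^{10 d₀+3} · Z(𝔻_δ, u, v, x)`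
(`mainEvent_bound`), provided the endpoints are `≥ 10` apart and farther than `d₀` from the
centre of `t'`. This is the list form of the printed
"`Z_{Θ_F}(x) · Z_F(x) ≤ 4^{100m} max(x⁶, x^{-100m+4}) Z_{(Ω,a,b)}(x)`" together with the Claim
`Z_F ≥ Z_m^{|F|}`, with `80 (d₀+1) max(1,x⁻¹)^{10 d₀+3}` in the role of the multiplicity and
length factor `4^{100m} max(x⁶, x^{-100m+4})`.
Proof: `Splice.weighted_sum_le` applied to the templates of `exists_template` (the two
exceptional endpoint configurations are excluded since the endpoints are far), the merged
excursions `OddTile.mergeList` of the configurations of `𝒞` (`sum_configs_pow_length`,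
`mergeList_toAssign_injOn`), the splice hypotheses being verified from clearness (the structure
lives in clear tiles, the lanes and tail in non-clear ones, `Splice.Data.l1dist_g_ctr_tileOf_le`)
and depth (everything within `ℓ¹`-distance `Rd` of the centre of `t'` is in the disk).
-/

noncomputable section

open Finset Literature.Probability.LatticeModels Literature.Probability.Percolation
  Literature.Probability.RandomPlanarGeometry.SAW

namespace Literature.Barriers.CriticalPhenomena

namespace SupercriticalSAW

variable {m r : ℕ} {δ : ℝ} {u v : Site 2}

/-! ### The main event -/

open Classical in
/-- **The main event** (tile form of the printed `Θ_F`, split by the sphere radius): the vertex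
lists of walks of `𝔻_δ` from `u` to `v` for which every tile of `𝒞` is clear with radius `ρ`,
whose open `ℓ¹`-ball of radius `d₀` about the centre of `t'` is free and whose sphere is met.
[cite: DuminilCopinKozmaYadin2014, §3 (Proposition 7: the walks Θ_F)] -/
def mainEvent (m r : ℕ) (δ : ℝ) (u v : Site 2) (ρ : ℤ) (𝒞 : Finset (Site 2)) (t' : Site 2) (d₀ : ℤ) :
    Finset (List (Site 2)) :=
  (domSawLists (zdGraph 2) (Dfin δ) u v).filter fun l =>
    (∀ τ ∈ 𝒞, IsClearTile m r l ρ τ) ∧ (∀ w ∈ l, d₀ ≤ l1dist w (OddTile.ctr m r t')) ∧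
      ∃ g ∈ l, l1dist g (OddTile.ctr m r t') = d₀

/-- Membership in the main event. [folklore] -/
theorem mem_mainEvent {ρ : ℤ} {𝒞 : Finset (Site 2)} {t' : Site 2} {d₀ : ℤ} {l : List (Site 2)} :
    l ∈ mainEvent m r δ u v ρ 𝒞 t' d₀ ↔ l ∈ domSawLists (zdGraph 2) (Dfin δ) u v ∧
      (∀ τ ∈ 𝒞, IsClearTile m r l ρ τ) ∧ (∀ w ∈ l, d₀ ≤ l1dist w (OddTile.ctr m r t')) ∧
      ∃ g ∈ l, l1dist g (OddTile.ctr m r t') = d₀ := by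
  classical
  rw [mainEvent, Finset.mem_filter]

/-! ### The template of a walk of the main event -/

/-- **A template applies to every walk of the main event** whose endpoints are `≥ 10` apart and
farther than `d₀` from the centre (so that the two exceptional endpoint configurations of the
cover theorem cannot occur). [cite: DuminilCopinKozmaYadin2014, §3 (proof of Proposition 7: existence of the link)] -/
theorem exists_template_of_mem_mainEvent {ρ : ℤ} {𝒞 : Finset (Site 2)} {t' : Site 2} {d₀ : ℤ}
    (hd : 3 ≤ d₀) (huv : 10 ≤ l1dist u v) (hfu : d₀ < l1dist u (OddTile.ctr m r t'))
    (hfv : d₀ < l1dist v (OddTile.ctr m r t')) {l : List (Site 2)} (hl : l ∈ mainEvent m r δ u v ρ 𝒞 t' d₀) :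
    ∃ T : Template, T.F.z₀ = OddTile.ctr m r t' ∧ T.WF d₀ ∧ T.Holds l := by
  rw [mem_mainEvent, mem_domSawLists] at hl
  obtain ⟨⟨hsaw, hhead, hlast⟩, -, hfree, hΓ⟩ := hl
  rcases exists_template hsaw.nodup hsaw.isChain hhead hlast huv (OddTile.ctr m r t') hd hfree hΓ with
    hT | ⟨G, hG, hB⟩ | ⟨G, hG, hB⟩
  · exact hT
  · exfalso
    have hend := hB.1
    have hdist : l1dist (G.fr 0 d₀) (OddTile.ctr m r t') = d₀ := by
      rw [← hG, G.l1dist_fr]; simp only [abs_zero, zero_add]; exact abs_of_nonneg (by omega)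
    rcases hend with h | h
    · rw [hhead] at h; simp only [Option.some.injEq] at h; rw [← h] at hdist; omega
    · rw [hlast] at h; simp only [Option.some.injEq] at h; rw [← h] at hdist; omega
  · exfalso
    have hend := hB.2.2.2
    have hdist : l1dist (G.fr 1 (d₀ - 1)) (OddTile.ctr m r t') = d₀ := by
      rw [← hG, G.l1dist_fr, abs_one, abs_of_nonneg (by omega)]; ring
    rcases hend with h | h
    · rw [hhead] at h; simp only [Option.some.injEq] at h; rw [← h] at hdist; omega
    · rw [hlast] at h; simp only [Option.some.injEq] at h; rw [← h] at hdist; omega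

/-- The junk template (used off the event): `TB1` at the standard frame. [folklore] -/
def junkTemplate (z₀ : Site 2) (d₀ : ℤ) : Template := ⟨Frame.std z₀, 0, d₀, .TB1⟩

/-- The junk template is well formed. [folklore] -/
theorem junkTemplate_wf (z₀ : Site 2) (d₀ : ℤ) : (junkTemplate z₀ d₀).WF d₀ := ⟨rfl, rfl⟩

/-! ### The bound -/

/-- **The energy–entropy bound of the main case (Proposition 7, tile form, proved).** See the
module docstring. [cite: DuminilCopinKozmaYadin2014, Proposition 7 and Claim (proof of Theorem 6)] -/
theorem mainEvent_bound (hδ : 0 < δ) (hr : 4 ≤ r) {x : ℝ} (hx : 0 < x) {ρ : ℤ} {Rd : ℕ}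
    {𝒞 : Finset (Site 2)} {t' : Site 2} {dp : Dir} {d₀ : ℤ}
    (h𝒞deep : ∀ τ ∈ 𝒞, IsDeepTile δ m r Rd τ) (h𝒞conn : IsGraphConnected (zdGraph 2) 𝒞)
    (ht' : t' ∉ 𝒞) (ht'deep : IsDeepTile δ m r Rd t') (ht : t' + dp.vec ∈ 𝒞)
    (hbig : 2 * Splice.A m r + 12 ≤ d₀) (hd₀L : 2 * (OddTile.side m r : ℤ) ≤ d₀) (hd₀ρ : d₀ ≤ ρ)
    (hρRd : ρ ≤ Rd) (huv : 10 ≤ l1dist u v) (hfu : d₀ < l1dist u (OddTile.ctr m r t'))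
    (hfv : d₀ < l1dist v (OddTile.ctr m r t')) :
    (∑ l ∈ mainEvent m r δ u v ρ 𝒞 t' d₀, x ^ (l.length - 1)) *
        (x ^ ((4 * r + 2) * (𝒞.card - 1)) * Zbox m x ^ 𝒞.card) ≤
      80 * (d₀ + 1) * max 1 x⁻¹ ^ (10 * d₀ + 3).toNat * listPartition (zdGraph 2) (Dfin δ) u v x := by
  classical
  set z₀ := OddTile.ctr m r t' with hz₀
  set t := t' + dp.vec with htdef
  have ht'eq : t' = t + dp.neg.vec := by rw [htdef, Dir.vec_neg]; abel
  have hd3 : 3 ≤ d₀ := by have := (Splice.rect_bounds (m := m) (r := r) (Frame.std z₀)).2.2.2.2; omega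
  have hhw := OddTile.hw_eq (m := m) (r := r)
  have hside := OddTile.side_eq (m := m) (r := r)
  -- the attachment sequence of `𝒞` rooted at `t`, avoiding `t'`
  obtain ⟨steps, hvalid, hnd, htiles, hlen⟩ := OddTile.exists_validFrom h𝒞conn ht ht'
  have hvalid' : OddTile.ValidFrom (t + dp.neg.vec) [t] steps := ht'eq ▸ hvalid
  -- the structures
  let ext : (∀ τ ∈ 𝒞, Finset (Sym2 (Site 2))) → List (Site 2) :=
    fun c => OddTile.mergeList m r (OddTile.toAssign 𝒞 c) t dp.neg steps
  have hext : Set.InjOn ext (OddTile.configs m r 𝒞) := OddTile.mergeList_toAssign_injOn hvalid ht'eq htiles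
  have hmemT : ∀ τ ∈ OddTile.tilesAfter [t] steps, τ ∈ 𝒞 := fun τ hτ => by
    rw [← htiles, List.mem_toFinset]; exact hτ
  have hI : ∀ c ∈ OddTile.configs m r 𝒞, OddTile.MergeInv m r (OddTile.toAssign 𝒞 c) t dp.neg
      (OddTile.entries t dp.neg steps) steps (ext c) := fun c hc =>
    OddTile.MergeInv.mergeList hvalid' (OddTile.toAssign_mem_tilePolygons hc ht) fun q hq =>
      OddTile.toAssign_mem_tilePolygons hc (hmemT _ (by
        rw [OddTile.tilesAfter]; exact List.mem_append_right _ (List.mem_map_of_mem hq)))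
  -- the templates (chosen once and for all; kept opaque)
  obtain ⟨Tf, hTf⟩ : ∃ Tf : List (Site 2) → Template, ∀ l, (Tf l).F.z₀ = z₀ ∧ (Tf l).WF d₀ ∧
      (l ∈ mainEvent m r δ u v ρ 𝒞 t' d₀ → (Tf l).Holds l) := by
    refine ⟨fun l => if hl : l ∈ mainEvent m r δ u v ρ 𝒞 t' d₀ then
      Classical.choose (exists_template_of_mem_mainEvent hd3 huv hfu hfv hl) else junkTemplate z₀ d₀, fun l => ?_⟩
    by_cases hl : l ∈ mainEvent m r δ u v ρ 𝒞 t' d₀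
    · have hs := Classical.choose_spec (exists_template_of_mem_mainEvent hd3 huv hfu hfv hl)
      simp only [dif_pos hl]
      exact ⟨hs.1, hs.2.1, fun _ => hs.2.2⟩
    · simp only [dif_neg hl]
      exact ⟨rfl, junkTemplate_wf z₀ d₀, fun h => absurd h hl⟩
  -- the splice data
  let Xf : List (Site 2) → (∀ τ ∈ 𝒞, Finset (Sym2 (Site 2))) → Splice.Data m r := fun l c =>
    ⟨Tf l, t', dp, ext c, d₀, (hTf l).2.1, (hTf l).1, hbig⟩
  -- the splice hypotheses
  have hHyp : ∀ l ∈ mainEvent m r δ u v ρ 𝒞 t' d₀, ∀ c ∈ OddTile.configs m r 𝒞,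
      (Xf l c).Hyp (Dfin δ) u v l := by
    intro l hl c hc
    have hl' := hl
    rw [mem_mainEvent] at hl'
    obtain ⟨hmem, hclear, hfree, hΓ⟩ := hl'
    have hIc := hI c hc
    -- vertices of the structure lie in clear deep tiles of `𝒞`
    have hSτ : ∀ w ∈ ext c, ∃ τ ∈ 𝒞, w ∈ OddTile.tile m r τ := fun w hw => by
      obtain ⟨τ, hτ, hwτ⟩ := hIc.exists_mem_tile hw
      rw [OddTile.map_fst_entries] at hτ
      exact ⟨τ, hmemT τ hτ, hwτ⟩
    have hρhw : 2 * (OddTile.hw m r : ℤ) ≤ ρ := by omega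
    have hRd : ∀ w : Site 2, l1dist w z₀ ≤ d₀ → w ∈ Dfin δ := fun w hw =>
      (mem_Dfin hδ).2 (ht'deep.mem_of_l1dist_le (by rw [← hz₀]; omega))
    refine ⟨hmem, (hTf l).2.2 hl, fun w hw => ?_, hIc.saw.isChain, hIc.saw.nodup, hIc.head, hIc.last,
      ?_, ?_, ?_, ?_, ?_, ?_⟩
    · -- the ball is free
      show d₀ ≤ l1dist w (Tf l).F.z₀
      rw [(hTf l).1]; exact hfree w hw
    · -- inside the domain
      intro w hw
      obtain ⟨τ, hτ, hwτ⟩ := hSτ w hw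
      exact (mem_Dfin hδ).2 ((h𝒞deep τ hτ).tile_subset (by omega) hwτ)
    · -- off the walk
      intro w hw
      obtain ⟨τ, hτ, hwτ⟩ := hSτ w hw
      exact (hclear τ hτ).not_mem hρhw hwτ
    · -- off the arena
      intro w hw
      refine hIc.not_mem_arena (τ₀ := t') ?_ hw
      rw [OddTile.map_fst_entries]
      exact fun h => ht' (hmemT _ h)
    · -- off the lanes and the tail: those lie in non-clear tiles
      intro w hw hwp
      obtain ⟨τ, hτ, hwτ⟩ := hSτ w hw
      have hτeq : OddTile.tileOf m r w = τ := OddTile.mem_tile_iff_tileOf_eq.1 hwτ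
      have hnear := (Xf l c).l1dist_g_ctr_tileOf_le hr hd₀ρ hd₀L hwp
      rw [hτeq] at hnear
      have hg : (Xf l c).T.g ∈ l := (Tf l).g_mem_of_holds ((hTf l).2.2 hl)
      have := hclear τ hτ _ hg
      omega
    · -- the domain contains the lanes and the tail
      intro w hw
      exact hRd w (by have := (Xf l c).l1dist_le_of_mem_pathSites hw; rw [(hTf l).1] at this; exact this)
    · -- the domain contains the arena
      intro w hw
      change w ∈ OddTile.arena m r t' at hw
      have h1 := OddTile.l1dist_le_of_mem_arena hw
      rw [← hz₀] at h1
      refine hRd w ?_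
      have hA : Splice.A m r = OddTile.hw m r + r := rfl
      rw [hA] at hbig
      omega
  -- the weighted bound
  have key := Splice.weighted_sum_le (m := m) (r := r) (Dfin δ) u v hx t' dp d₀
    (mainEvent m r δ u v ρ 𝒞 t' d₀) Tf (OddTile.configs m r 𝒞) ext hext Xf
    (fun l hl c hc => ⟨rfl, rfl, rfl, rfl, rfl, hHyp l hl c hc⟩) (by omega)
  -- the left-hand side factorises
  have hsum : ∀ l : List (Site 2), ∑ c ∈ OddTile.configs m r 𝒞, x ^ (l.length - 1 + (ext c).length) =
      x ^ (l.length - 1) * (x ^ ((4 * r + 2) * (𝒞.card - 1)) * Zbox m x ^ 𝒞.card) := by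
    intro l
    rw [← OddTile.sum_configs_pow_length (m := m) (r := r) hvalid ht'eq hnd htiles x, Finset.mul_sum]
    refine Finset.sum_congr rfl fun c _ => ?_
    rw [pow_add]
  simp only [hsum] at key
  rw [← Finset.sum_mul] at key
  exact key

end SupercriticalSAW

end Literature.Barriers.CriticalPhenomena
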